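import Mathlib
import Literature.Analysis.FluidPDE.SelfSimilarEulerProfileVorticity
import Literature.Analysis.FluidPDE.WholeSpaceIBP
import HarnessLib

/-!
# WEAK TRACE TOOLS: scale calculus of vector pairings and THE WEAK PROFILE IDENTITY against divergence-free tests
# (statement-agnostic infrastructure for nsreg-p2 ROUND-54 «THE TRACE», plate t59-TR; seat ns-ezl-w3 g8, `--supports stmt-NavierStokesRegularity-19832 --as helper`)

For a `C²` self-similar Euler profile `(V, P)` with exponent `γ = 1/(2+ρ)`, centre `0`, and the `A`-gauge budget `∫_{B_R}‖V‖² ≤ A·R^{1−2ρ}` (`R ≥ 1`), and a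
DIVERGENCE-FREE test field `φ ∈ C¹_c(ℝ³;ℝ³)`, the pairing `F(λ) = λ^{ρ−2}∫⟪V(y), φ(λ⁻¹y)⟫dy = ∫⟪λ^{1+ρ}V(λx), φ(x)⟫dx` has ONE scale derivative,
identified PRESSURE-FREE through the weak profile equation, and bounded by the `A`-budget alone:
`F′(λ) = (2+ρ)·λ^{ρ−4}·∫⟪V(y), Dφ(λ⁻¹y)[V(y)]⟫dy`, `|F′(λ)| ≤ (2+ρ)B₁A r^{1−2ρ}·λ^{−3−ρ}` — INTEGRABLE, so `F(λ) → F_∞` with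
`|F(λ) − F_∞| ≤ C·λ^{−(2+ρ)}`: the blow-up-time trace `u(0⁻,·)` of the physical solution EXISTS weakly on div-free tests (SEEDS-R54 S2 dictionary).

* `WeakTrace.exists_bounds_of_vectorWeight`, `WeakTrace.hasDerivAt_dilate_scale_vec`, `WeakTrace.hasDerivAt_dilatedPairing` — the scale calculus of
  `λ ↦ ∫⟪V y, Φ(λ⁻¹y)⟫` for continuous `V` and `Φ ∈ C¹_c` (the vector form of ns-sfl-p1 g9's `TwoSidedMoment.hasDerivAt_dilatedMoment`);
* `WeakTrace.weakProfileIdentity` — **the weak profile identity against div-free tests**: `(1 − 4γ)∫⟪V, ψ⟫ = ∫⟪V, Dψ[γy + V]⟫` (from the pointwise profile equation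
  `(1−γ)V + DV[γy + V] + ∇P = 0`, the trilinear convection identity `integral_inner_convect_add_eq_zero` with `div(γy + V) = 3γ`, and `∫⟪∇P, ψ⟫ = −∫P·div ψ = 0`);
The scale derivative `F′(λ) = (2+ρ)λ^{ρ−4}∫⟪V y, Dφ(λ⁻¹y)[V y]⟫` and the law itself (limit + rate) are in the companion `…WeakTraceLaw.lean`.

HONEST FRAMING: a portrait instrument about HYPOTHETICAL profiles (the trace exists as a functional on div-free test fields; nothing is claimed about gradient parts);
nothing about the crux E (`PowerGaugeEulerLiouville`, stmt 19832, OPEN) or NS regularity is proved; MODEL-lattice crux class; not E. [nsreg-p2 SEEDS-R54 S2/S3; folklore]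
-/

noncomputable section

set_option linter.dupNamespace false

open MeasureTheory Set Filter Topology Metric Function TopologicalSpace
open scoped ENNReal NNReal RealInnerProductSpace Topology

namespace Summit.NavierStokesRegularity.NavierStokesRegularity.Theorems.PowerGaugeEulerLiouville

open Literature.Analysis Literature.Analysis.FluidPDE

namespace WeakTrace

variable {Φ : EuclideanSpace ℝ (Fin 3) → EuclideanSpace ℝ (Fin 3)} {V : EuclideanSpace ℝ (Fin 3) → EuclideanSpace ℝ (Fin 3)}

/-! ## Scale calculus of the vector pairing `λ ↦ ∫⟪V y, Φ(λ⁻¹y)⟫` -/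

/-- A `C¹_c` vector weight has bounded values, a bounded derivative, and vanishes (with its derivative) off a ball. [folklore] -/
theorem exists_bounds_of_vectorWeight (hΦ : ContDiff ℝ 1 Φ) (hΦc : HasCompactSupport Φ) :
    ∃ B₀ B₁ r : ℝ, 0 ≤ B₀ ∧ 0 ≤ B₁ ∧ 0 < r ∧ (∀ x, ‖Φ x‖ ≤ B₀) ∧ (∀ x, ‖fderiv ℝ Φ x‖ ≤ B₁) ∧
      (∀ x, r ≤ ‖x‖ → Φ x = 0) ∧ (∀ x, r ≤ ‖x‖ → fderiv ℝ Φ x = 0) := by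
  obtain ⟨B₀, hB₀⟩ := hΦc.exists_bound_of_continuous hΦ.continuous
  have hDc : HasCompactSupport (fderiv ℝ Φ) := hΦc.fderiv (𝕜 := ℝ)
  obtain ⟨B₁, hB₁⟩ := hDc.exists_bound_of_continuous (hΦ.continuous_fderiv one_ne_zero)
  obtain ⟨r₀, hr₀⟩ := (hΦc.isCompact.isBounded).subset_closedBall (0 : EuclideanSpace ℝ (Fin 3))
  obtain ⟨r₁, hr₁⟩ := (hDc.isCompact.isBounded).subset_closedBall (0 : EuclideanSpace ℝ (Fin 3))
  refine ⟨max B₀ 0, max B₁ 0, max (max r₀ r₁) 0 + 1, le_max_right _ _, le_max_right _ _, by positivity,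
    fun x => (hB₀ x).trans (le_max_left _ _), fun x => (hB₁ x).trans (le_max_left _ _), fun x hx => ?_, fun x hx => ?_⟩
  · have hx' : x ∉ tsupport Φ := by
      intro h
      have := hr₀ h
      rw [mem_closedBall, dist_zero_right] at this
      linarith [le_max_left r₀ r₁, le_max_left (max r₀ r₁) 0]
    exact image_eq_zero_of_notMem_tsupport hx'
  · have hx' : x ∉ tsupport (fderiv ℝ Φ) := by
      intro h
      have := hr₁ h
      rw [mem_closedBall, dist_zero_right] at this
      linarith [le_max_right r₀ r₁, le_max_left (max r₀ r₁) 0]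
    exact image_eq_zero_of_notMem_tsupport hx'

/-- The chain rule in the scale for a vector weight: `d/dR Φ(R⁻¹y) = DΦ(R⁻¹y)[−R⁻²·y]` (`R ≠ 0`). [folklore] -/
theorem hasDerivAt_dilate_scale_vec (hΦ : ContDiff ℝ 1 Φ) {R : ℝ} (hR : R ≠ 0) (y : EuclideanSpace ℝ (Fin 3)) :
    HasDerivAt (fun R : ℝ => Φ (R⁻¹ • y)) (fderiv ℝ Φ (R⁻¹ • y) ((-(R ^ 2)⁻¹) • y)) R := by
  have h1 : HasDerivAt (fun R : ℝ => R⁻¹ • y) ((-(R ^ 2)⁻¹) • y) R := (hasDerivAt_inv hR).smul_const y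
  have h2 : HasFDerivAt Φ (fderiv ℝ Φ (R⁻¹ • y)) (R⁻¹ • y) := (hΦ.differentiable one_ne_zero _).hasFDerivAt
  exact h2.comp_hasDerivAt R h1

/-- **Differentiation under the integral in the scale, vector pairing**: for continuous `V` and `Φ ∈ C¹_c(ℝ³;ℝ³)`, at every `R₀ > 0`,
`d/dR ∫⟪V y, Φ(R⁻¹y)⟫dy = ∫⟪V y, DΦ(R₀⁻¹y)[−R₀⁻²y]⟫dy` (dominated differentiation on `R ∈ (R₀/2, 2R₀)`; the vector form of
`TwoSidedMoment.hasDerivAt_dilatedMoment`). [folklore] -/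
theorem hasDerivAt_dilatedPairing (hΦ : ContDiff ℝ 1 Φ) (hΦc : HasCompactSupport Φ) (hV : Continuous V) {R₀ : ℝ} (hR₀ : 0 < R₀) :
    HasDerivAt (fun R : ℝ => ∫ y, ⟪V y, Φ (R⁻¹ • y)⟫)
      (∫ y, ⟪V y, fderiv ℝ Φ (R₀⁻¹ • y) ((-(R₀ ^ 2)⁻¹) • y)⟫) R₀ := by
  obtain ⟨B₀, B₁, r, hB₀, hB₁, hr, hΦB, hDΦB, hΦ0, hDΦ0⟩ := exists_bounds_of_vectorWeight hΦ hΦc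
  have hI : Ioo (R₀ / 2) (2 * R₀) ∈ 𝓝 R₀ := Ioo_mem_nhds (by linarith) (by linarith)
  have hΦcont : Continuous Φ := hΦ.continuous
  have hDΦc : Continuous (fderiv ℝ Φ) := hΦ.continuous_fderiv one_ne_zero
  have hsm : ∀ c : ℝ, Continuous fun y : EuclideanSpace ℝ (Fin 3) => c • y := fun c => continuous_const_smul c
  have hFc : ∀ R : ℝ, Continuous fun y : EuclideanSpace ℝ (Fin 3) => ⟪V y, Φ (R⁻¹ • y)⟫ :=
    fun R => hV.inner (hΦcont.comp (hsm R⁻¹))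
  have hF'c : ∀ R : ℝ, Continuous fun y : EuclideanSpace ℝ (Fin 3) => ⟪V y, fderiv ℝ Φ (R⁻¹ • y) ((-(R ^ 2)⁻¹) • y)⟫ :=
    fun R => hV.inner ((hDΦc.comp (hsm R⁻¹)).clm_apply (hsm _))
  -- compact support of the pairing at `R₀`
  have hsuppF : HasCompactSupport fun y : EuclideanSpace ℝ (Fin 3) => ⟪V y, Φ (R₀⁻¹ • y)⟫ := by
    refine HasCompactSupport.of_support_subset_isCompact (isCompact_closedBall (0 : EuclideanSpace ℝ (Fin 3)) (r * R₀)) fun y hy => ?_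
    rw [mem_closedBall, dist_zero_right]
    by_contra hcon
    have hfar : r ≤ ‖R₀⁻¹ • y‖ := by
      rw [norm_smul, norm_inv, Real.norm_eq_abs, abs_of_pos hR₀, le_inv_mul_iff₀ hR₀]
      linarith [not_le.1 hcon]
    exact hy (by simp only [hΦ0 _ hfar, inner_zero_right])
  set bound : EuclideanSpace ℝ (Fin 3) → ℝ := fun y =>
    (closedBall (0 : EuclideanSpace ℝ (Fin 3)) (2 * r * R₀)).indicator (fun y => ‖V y‖ * (B₁ * (((R₀ / 2) ^ 2)⁻¹ * ‖y‖))) y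
    with hbound
  have hbound_int : Integrable bound volume := by
    rw [hbound, integrable_indicator_iff isClosed_closedBall.measurableSet]
    exact (hV.norm.mul (continuous_const.mul (continuous_const.mul continuous_norm))).continuousOn.integrableOn_compact
      (isCompact_closedBall _ _)
  refine (hasDerivAt_integral_of_dominated_loc_of_deriv_le (μ := volume)
    (F := fun (R : ℝ) (y : EuclideanSpace ℝ (Fin 3)) => ⟪V y, Φ (R⁻¹ • y)⟫)
    (F' := fun (R : ℝ) (y : EuclideanSpace ℝ (Fin 3)) => ⟪V y, fderiv ℝ Φ (R⁻¹ • y) ((-(R ^ 2)⁻¹) • y)⟫)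
    (bound := bound) hI ?_ ?_ ?_ ?_ hbound_int ?_).2
  · exact Eventually.of_forall fun R => (hFc R).aestronglyMeasurable
  · exact (hFc R₀).integrable_of_hasCompactSupport hsuppF
  · exact (hF'c R₀).aestronglyMeasurable
  · refine ae_of_all _ fun y R hR => ?_
    have hR0 : 0 < R := by linarith [hR.1]
    by_cases hy : 2 * r * R₀ < ‖y‖
    · have hfar : r ≤ ‖R⁻¹ • y‖ := by
        rw [norm_smul, norm_inv, Real.norm_eq_abs, abs_of_pos hR0, le_inv_mul_iff₀ hR0]
        nlinarith [hR.2, hr]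
      rw [hDΦ0 _ hfar]
      simp only [zero_apply, inner_zero_right, norm_zero, hbound]
      exact indicator_nonneg (fun z _ => by positivity) y
    · push Not at hy
      have hyb : y ∈ closedBall (0 : EuclideanSpace ℝ (Fin 3)) (2 * r * R₀) := by
        rw [mem_closedBall, dist_zero_right]; exact hy
      simp only [hbound, indicator_of_mem hyb]
      have h1 : ‖fderiv ℝ Φ (R⁻¹ • y) ((-(R ^ 2)⁻¹) • y)‖ ≤ B₁ * (((R₀ / 2) ^ 2)⁻¹ * ‖y‖) := by
        calc ‖fderiv ℝ Φ (R⁻¹ • y) ((-(R ^ 2)⁻¹) • y)‖ ≤ ‖fderiv ℝ Φ (R⁻¹ • y)‖ * ‖(-(R ^ 2)⁻¹) • y‖ :=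
              (fderiv ℝ Φ (R⁻¹ • y)).le_opNorm _
          _ ≤ B₁ * (((R₀ / 2) ^ 2)⁻¹ * ‖y‖) := by
              rw [norm_smul, norm_neg, norm_inv, Real.norm_eq_abs, abs_of_pos (by positivity : (0 : ℝ) < R ^ 2)]
              have h3 : (R ^ 2)⁻¹ ≤ ((R₀ / 2) ^ 2)⁻¹ := by
                apply inv_anti₀ (by positivity)
                have : R₀ / 2 ≤ R := hR.1.le
                nlinarith [hR₀]
              gcongr
              exact hDΦB _
      calc ‖⟪V y, fderiv ℝ Φ (R⁻¹ • y) ((-(R ^ 2)⁻¹) • y)⟫‖ ≤ ‖V y‖ * ‖fderiv ℝ Φ (R⁻¹ • y) ((-(R ^ 2)⁻¹) • y)‖ :=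
            norm_inner_le_norm _ _
        _ ≤ ‖V y‖ * (B₁ * (((R₀ / 2) ^ 2)⁻¹ * ‖y‖)) := mul_le_mul_of_nonneg_left h1 (norm_nonneg _)
  · refine ae_of_all _ fun y R hR => ?_
    have hR0 : R ≠ 0 := by linarith [hR.1]
    have h := (hasDerivAt_const R (V y)).inner ℝ (hasDerivAt_dilate_scale_vec hΦ hR0 y)
    refine h.congr_deriv ?_
    rw [inner_zero_left, add_zero]

/-! ## The weak profile identity against divergence-free tests -/

/-- **THE WEAK PROFILE IDENTITY** (pressure-free): for a classical self-similar Euler profile `(V, P)` with exponent `γ` and centre `0`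
(`(1−γ)V + DV[γy + V] + ∇P = 0`, `div V = 0`) and a divergence-free test field `ψ ∈ C¹_c(ℝ³;ℝ³)`:
`(1 − 4γ)·∫⟪V, ψ⟫ = ∫⟪V(y), Dψ(y)[γy + V(y)]⟫` — pair the profile equation with `ψ`, move the transport derivative onto `ψ` by the trilinear identity
`∫⟪(W·∇)V, ψ⟫ + ∫⟪V, (W·∇)ψ⟫ + ∫(div W)⟪V, ψ⟫ = 0` (`W = γy + V`, `div W = 3γ`), and drop the pressure by `∫⟪∇P, ψ⟫ = −∫P·div ψ = 0`.
[cite: Leray1934, §6 (1.11) p. 203 (the IBP); nsreg-p2 SEEDS-R54 S2] -/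
theorem weakProfileIdentity {γ : ℝ} {P : EuclideanSpace ℝ (Fin 3) → ℝ} (hprof : IsSelfSimilarEulerProfile γ 0 V P)
    {ψ : EuclideanSpace ℝ (Fin 3) → EuclideanSpace ℝ (Fin 3)} (hψ : ContDiff ℝ 1 ψ) (hψc : HasCompactSupport ψ)
    (hdiv : ∀ y, VectorCalculus.divergence ψ y = 0) :
    (1 - 4 * γ) * ∫ y, ⟪V y, ψ y⟫ = ∫ y, ⟪V y, fderiv ℝ ψ y (γ • y + V y)⟫ := by
  have hV2 : ContDiff ℝ 2 V := hprof.contDiff_velocity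
  have hV1 : ContDiff ℝ 1 V := hV2.of_le one_le_two
  have hVd : Differentiable ℝ V := hprof.differentiable_velocity
  have hP1 : ContDiff ℝ 1 P := hprof.contDiff_pressure
  set W : EuclideanSpace ℝ (Fin 3) → EuclideanSpace ℝ (Fin 3) := selfSimilarTransport γ 0 V with hWdef
  have hWapply : ∀ y, W y = γ • y + V y := fun y => by rw [hWdef, selfSimilarTransport_apply, sub_zero]
  have hW1 : ContDiff ℝ 1 W := by
    have : W = fun y => γ • (y - 0) + V y := by funext y; rw [hWdef, selfSimilarTransport_apply]
    rw [this]
    exact ((contDiff_id.sub contDiff_const).const_smul γ).add hV1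
  have hdivW : ∀ y, VectorCalculus.divergence W y = 3 * γ := fun y =>
    divergence_selfSimilarTransport hVd hprof.divFree y
  -- the pointwise profile equation, paired with `ψ`
  have hpt : ∀ y, ⟪(1 - γ) • V y + convect W V y + gradient P y, ψ y⟫ = 0 := fun y => by
    have h := hprof.profile_eq y
    rw [convect, hWapply, ← sub_zero y]
    simp only [sub_zero] at h ⊢
    rw [h, inner_zero_left]
  -- integrability of the three pieces (continuous × compactly supported `ψ`)
  have hψcont : Continuous ψ := hψ.continuous
  have hsupp : ∀ {f : EuclideanSpace ℝ (Fin 3) → EuclideanSpace ℝ (Fin 3)}, Continuous f →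
      Integrable (fun y => ⟪f y, ψ y⟫) := fun hf =>
    (hf.inner hψcont).integrable_of_hasCompactSupport (hψc.mono fun y hy => by contrapose! hy; simp_all)
  have hI1 : Integrable (fun y => ⟪(1 - γ) • V y, ψ y⟫) := hsupp (hV1.continuous.fun_const_smul (1 - γ))
  have hI2 : Integrable (fun y => ⟪convect W V y, ψ y⟫) :=
    hsupp ((hV1.continuous_fderiv one_ne_zero).clm_apply hW1.continuous)
  have hI3 : Integrable (fun y => ⟪gradient P y, ψ y⟫) := hsupp (continuous_gradient_of_contDiff hP1)
  have hI12 : Integrable (fun y => ⟪(1 - γ) • V y, ψ y⟫ + ⟪convect W V y, ψ y⟫) := hI1.add hI2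
  have hsum : (∫ y, ⟪(1 - γ) • V y, ψ y⟫) + (∫ y, ⟪convect W V y, ψ y⟫) + ∫ y, ⟪gradient P y, ψ y⟫ = 0 := by
    have h0 : ∫ y, (⟪(1 - γ) • V y, ψ y⟫ + ⟪convect W V y, ψ y⟫ + ⟪gradient P y, ψ y⟫) = 0 := by
      have e : (fun y => ⟪(1 - γ) • V y, ψ y⟫ + ⟪convect W V y, ψ y⟫ + ⟪gradient P y, ψ y⟫) = fun _ => (0 : ℝ) :=
        funext fun y => by rw [← inner_add_left, ← inner_add_left]; exact hpt y
      rw [e, integral_zero]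
    rw [integral_add hI12 hI3, integral_add hI1 hI2] at h0
    exact h0
  -- the trilinear identity and the pressure
  have htri := integral_inner_convect_add_eq_zero hW1 hV1 hψ hψc
  have hpress : ∫ y, ⟪gradient P y, ψ y⟫ = 0 := by
    rw [integral_inner_gradient_eq_neg_integral_mul_divergence hP1 hψ hψc]
    simp [hdiv]
  have e1 : ∫ y, ⟪(1 - γ) • V y, ψ y⟫ = (1 - γ) * ∫ y, ⟪V y, ψ y⟫ := by
    rw [← integral_const_mul]
    exact integral_congr_ae (ae_of_all _ fun y => by simp only [real_inner_smul_left])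
  have e2 : ∫ y, VectorCalculus.divergence W y * ⟪V y, ψ y⟫ = 3 * γ * ∫ y, ⟪V y, ψ y⟫ := by
    rw [← integral_const_mul]
    exact integral_congr_ae (ae_of_all _ fun y => by simp only [hdivW y])
  have e3 : ∫ y, ⟪V y, convect W ψ y⟫ = ∫ y, ⟪V y, fderiv ℝ ψ y (γ • y + V y)⟫ :=
    integral_congr_ae (ae_of_all _ fun y => by simp only [convect, hWapply])
  rw [e1, hpress, add_zero] at hsum
  rw [e2, e3] at htri
  linarith

end WeakTrace

end Summit.NavierStokesRegularity.NavierStokesRegularity.Theorems.PowerGaugeEulerLiouville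

end
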